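import Literature.Computability.Complexity.SymmetricThresholdProgramsCounting
import Literature.Combinatorics.SimpleGraph.ColourRefinementOrder
import HarnessLib

/-!
# Symmetric threshold programs: one round of ORDERED colour refinement on a wire-given part

A reusable GADGET for symmetric threshold programs (`SymProg`): the refinement step of every
individualisation–refinement canoniser, in the form the window canoniser of route
`PneNP/SymmetryBudget` (item `NoHiddenOrder`) needs it — relative to a DATA-DEPENDENT part.
Inputs (wires): membership `mem u` of the current part `U`, adjacency `adj u v`, and the ORDER of
the current colouring on the part (`lt u v = [col u < col v]`, `eq u v = [col u = col v]`).
Outputs: the order of the refined colouring `ocrStep G_U col` of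
`Literature/Combinatorics/SimpleGraph/ColourRefinementOrder.lean` on the induced graph `G_U` of the
part (new colour = number of part vertices with a smaller key; key = old colour, then the vector of
neighbour counts per old colour, lexicographically):

* `RefineRound.sem_lt'_iff` — for members `a b`, `lt' a b` carries `ocrStep G_U col a < ocrStep G_U col b`;
* `RefineRound.sem_eq'_iff` — `eq' a b` carries `ocrStep G_U col a = ocrStep G_U col b`.

So rounds compose with no further gates: the outputs `lt'`/`eq'` of a round over `mem`, `adj` are
the inputs `lt`/`eq` of the next round over the SAME `mem`, `adj` (then the parts agree
definitionally and `sem_lt'_iff`/`sem_eq'_iff` are exactly the next round's `Reads` for the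
colouring `ocrStep G_U col`), and the colouring function is never materialised: only its order
is carried (`ocrStep_congr`: the step depends on the colouring only through kernel and order).  Counting is
done by the `CmpCount` gadget (`SymmetricThresholdProgramsCounting.lean`).  Gate count `O(|V|⁴ + |V|³·N)`.

## References
* J.-Y. Cai, M. Fürer, N. Immerman, *An optimal lower bound on the number of variables for graph
  identification*, Combinatorica 12 (1992), §5 (vertex refinement with sorted colours)
  [CaiFurerImmerman1992].
* M. Anderson, A. Dawar, *On symmetric circuits and fixed-point logics*, Theory Comput. Syst. 60
  (2017), §3 [AndersonDawar2016].
-/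

namespace Literature.Computability.Complexity

open Finset Literature.Combinatorics.SimpleGraph

namespace SymProg

variable {ι Λ : Type*} [DecidableEq ι] [DecidableEq Λ] (P : SymProg ι Λ)
variable (V : Type*) [Fintype V] (N : ℕ)

/-- **The refinement-round gadget** inside `P` over the vertex type `V` with count bound `N`.
[cite: CaiFurerImmerman1992, §5 (vertex refinement)] -/
structure RefineRound where
  /-- membership wire of the current part -/
  mem : V → ι ⊕ Λ
  /-- adjacency wire -/
  adj : V → V → ι ⊕ Λ
  /-- order wire of the current colouring: `[col u < col v]` -/
  lt : V → V → ι ⊕ Λ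
  /-- kernel wire of the current colouring: `[col u = col v]` -/
  eq : V → V → ι ⊕ Λ
  /-- `c u w y`: `y` is a member, adjacent to `u`, of the colour of `w` -/
  c : V → V → V → Λ
  /-- the comparison of the counts `#{y | c u w y}` and `#{y | c v w y}` -/
  cmp : V → V → V → P.CmpCount N
  /-- `nmem w = ¬ mem w` -/
  nmem : V → Λ
  /-- `nlt w' w = ¬ lt w' w` -/
  nlt : V → V → Λ
  /-- `pre u v w w'`: if `w'` is a member of smaller colour than `w`, the counts of `u`, `v` at `w'` agree -/
  pre : V → V → V → V → Λ
  /-- `allpre u v w = ∀ w', pre u v w w'` -/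
  allpre : V → V → V → Λ
  /-- `wit u v w`: `w` is a member witnessing that the count vector of `u` is lexicographically smaller -/
  wit : V → V → V → Λ
  /-- `prof u v = ∃ w, wit u v w` -/
  prof : V → V → Λ
  /-- `tie u v = eq u v ∧ prof u v` -/
  tie : V → V → Λ
  /-- OUTPUT `lt' u v`: the key of `u` is smaller (the refined colour of `u` is smaller) -/
  lt' : V → V → Λ
  /-- OUTPUT `eq' u v = ¬lt' u v ∧ ¬lt' v u`: equal refined colours -/
  eq' : V → V → Λ
  c_injective : ∀ u w, Function.Injective (c u w)
  kind_c : ∀ u w y, P.kind (c u w y) = Kind.and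
  srcs_c : ∀ u w y, P.srcs (c u w y) = {mem y, adj u y, eq y w}
  cmp_A : ∀ u v w, (cmp u v w).A = univ.image fun y => Sum.inr (c u w y)
  cmp_B : ∀ u v w, (cmp u v w).B = univ.image fun y => Sum.inr (c v w y)
  kind_nmem : ∀ w, P.kind (nmem w) = Kind.nor
  srcs_nmem : ∀ w, P.srcs (nmem w) = {mem w}
  kind_nlt : ∀ w' w, P.kind (nlt w' w) = Kind.nor
  srcs_nlt : ∀ w' w, P.srcs (nlt w' w) = {lt w' w}
  kind_pre : ∀ u v w w', P.kind (pre u v w w') = Kind.or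
  srcs_pre : ∀ u v w w', P.srcs (pre u v w w') =
    {Sum.inr (nmem w'), Sum.inr (nlt w' w), Sum.inr (cmp u v w').eq}
  kind_allpre : ∀ u v w, P.kind (allpre u v w) = Kind.and
  srcs_allpre : ∀ u v w, P.srcs (allpre u v w) = univ.image fun w' => Sum.inr (pre u v w w')
  kind_wit : ∀ u v w, P.kind (wit u v w) = Kind.and
  srcs_wit : ∀ u v w, P.srcs (wit u v w) = {mem w, Sum.inr (cmp u v w).lt, Sum.inr (allpre u v w)}
  kind_prof : ∀ u v, P.kind (prof u v) = Kind.or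
  srcs_prof : ∀ u v, P.srcs (prof u v) = univ.image fun w => Sum.inr (wit u v w)
  kind_tie : ∀ u v, P.kind (tie u v) = Kind.and
  srcs_tie : ∀ u v, P.srcs (tie u v) = {eq u v, Sum.inr (prof u v)}
  kind_lt' : ∀ u v, P.kind (lt' u v) = Kind.or
  srcs_lt' : ∀ u v, P.srcs (lt' u v) = {lt u v, Sum.inr (tie u v)}
  kind_eq' : ∀ u v, P.kind (eq' u v) = Kind.nor
  srcs_eq' : ∀ u v, P.srcs (eq' u v) = {Sum.inr (lt' u v), Sum.inr (lt' v u)}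

namespace RefineRound

variable {P V N} (R : P.RefineRound V N) (x : ι → Bool)

/-- The membership predicate on input `x`. [folklore] -/
def Mem (u : V) : Prop := wval x (P.sem x) (R.mem u) = true

/-- Membership is decidable. [folklore] -/
instance : DecidablePred (R.Mem x) := fun u => by unfold Mem; infer_instance

/-- The current part on input `x`. [folklore] -/
def part : Finset V := univ.filter fun u => R.Mem x u

/-- Membership in the part. [folklore] -/
theorem mem_part {u : V} : u ∈ R.part x ↔ R.Mem x u := by simp [part]

/-- **Interpretation data**: a simple graph on the part whose adjacency is read by the `adj` wires,
and a colouring of the part whose order and kernel are read by the `lt`/`eq` wires. [folklore] -/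
structure Reads (G : _root_.SimpleGraph (R.part x)) (col : R.part x → ℕ) : Prop where
  /-- adjacency wires read the graph -/
  adj_iff : ∀ a b : R.part x, wval x (P.sem x) (R.adj a b) = true ↔ G.Adj a b
  /-- order wires read the order of the colouring -/
  lt_iff : ∀ a b : R.part x, wval x (P.sem x) (R.lt a b) = true ↔ col a < col b
  /-- kernel wires read the kernel of the colouring -/
  eq_iff : ∀ a b : R.part x, wval x (P.sem x) (R.eq a b) = true ↔ col a = col b

variable {R x} {G : _root_.SimpleGraph (R.part x)} {col : R.part x → ℕ}

/-- `c u w y` for members. [folklore] -/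
theorem sem_c (h : R.Reads x G col) (a w : R.part x) (y : V) :
    P.sem x (R.c a w y) = true ↔ ∃ hy : R.Mem x y, G.Adj a ⟨y, (R.mem_part x).2 hy⟩ ∧
      col ⟨y, (R.mem_part x).2 hy⟩ = col w := by
  rw [P.sem_and (R.kind_c a w y), R.srcs_c]
  simp only [mem_insert, mem_singleton, forall_eq_or_imp, forall_eq]
  constructor
  · rintro ⟨hm, ha, he⟩
    refine ⟨hm, ?_, ?_⟩
    · exact (h.adj_iff a ⟨y, _⟩).1 ha
    · exact (h.eq_iff ⟨y, _⟩ w).1 he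
  · rintro ⟨hm, ha, he⟩
    exact ⟨hm, (h.adj_iff a ⟨y, _⟩).2 ha, (h.eq_iff ⟨y, _⟩ w).2 he⟩

/-- The count behind `cmp`: the number of `y` with `c u w y`, as a true count of the image set. [folklore] -/
theorem trueCount_image_c (u w : V) :
    P.trueCount x (univ.image fun y => Sum.inr (R.c u w y)) =
      (univ.filter fun y => P.sem x (R.c u w y) = true).card := by
  unfold trueCount
  rw [Finset.filter_image, Finset.card_image_of_injective]
  · rfl
  · intro y y' hy
    exact R.c_injective u w (Sum.inr_injective hy)

variable [DecidableRel G.Adj]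

/-- **The counts are the neighbour counts of the literature definition** on the part. [folklore] -/
theorem count_eq_nbrCount (h : R.Reads x G col) (a w : R.part x) :
    (univ.filter fun y => P.sem x (R.c a w y) = true).card = nbrCount G col a (col w) := by
  unfold nbrCount
  refine Finset.card_bij (fun y hy => ⟨y, (R.mem_part x).2 ((sem_c h a w y).1 (mem_filter.1 hy).2).1⟩)
    ?_ ?_ ?_
  · intro y hy
    obtain ⟨hm, hadj, hcol⟩ := (sem_c h a w y).1 (mem_filter.1 hy).2
    exact mem_filter.2 ⟨mem_univ _, hadj, hcol⟩
  · intro y _ y' _ hyy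
    exact congrArg Subtype.val hyy
  · rintro ⟨y, hyU⟩ hy
    obtain ⟨-, hadj, hcol⟩ := mem_filter.1 hy
    refine ⟨y, mem_filter.2 ⟨mem_univ _, (sem_c h a w y).2 ⟨(R.mem_part x).1 hyU, hadj, hcol⟩⟩, rfl⟩

/-- Neighbour counts are bounded by the size of the part. [folklore] -/
theorem nbrCount_le_card (a : R.part x) (cc : ℕ) : nbrCount G col a cc ≤ (R.part x).card := by
  unfold nbrCount
  exact (Finset.card_filter_le _ _).trans (by rw [Finset.card_univ, Fintype.card_coe])

/-- `cmp … .eq`: equal counts. [folklore] -/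
theorem sem_cmp_eq (h : R.Reads x G col) (hN : (R.part x).card ≤ N) (a b w : R.part x) :
    P.sem x (R.cmp a b w).eq = true ↔ nbrCount G col a (col w) = nbrCount G col b (col w) := by
  have hA : (R.cmp a b w).a x = nbrCount G col a (col w) := by
    show P.trueCount x (R.cmp a b w).A = _
    rw [R.cmp_A, trueCount_image_c, count_eq_nbrCount h]
  have hB : (R.cmp a b w).b x = nbrCount G col b (col w) := by
    show P.trueCount x (R.cmp a b w).B = _
    rw [R.cmp_B, trueCount_image_c, count_eq_nbrCount h]
  rw [(R.cmp a b w).sem_eq x (by rw [hA]; exact (nbrCount_le_card a _).trans hN)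
    (by rw [hB]; exact (nbrCount_le_card b _).trans hN), hA, hB]

/-- `cmp … .lt`: smaller count. [folklore] -/
theorem sem_cmp_lt (h : R.Reads x G col) (hN : (R.part x).card ≤ N) (a b w : R.part x) :
    P.sem x (R.cmp a b w).lt = true ↔ nbrCount G col a (col w) < nbrCount G col b (col w) := by
  have hA : (R.cmp a b w).a x = nbrCount G col a (col w) := by
    show P.trueCount x (R.cmp a b w).A = _
    rw [R.cmp_A, trueCount_image_c, count_eq_nbrCount h]
  have hB : (R.cmp a b w).b x = nbrCount G col b (col w) := by
    show P.trueCount x (R.cmp a b w).B = _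
    rw [R.cmp_B, trueCount_image_c, count_eq_nbrCount h]
  rw [(R.cmp a b w).sem_lt x (by rw [hB]; exact (nbrCount_le_card b _).trans hN), hA, hB]

/-- `pre u v w w'`. [folklore] -/
theorem sem_pre (h : R.Reads x G col) (hN : (R.part x).card ≤ N) (a b w : R.part x) (w' : V) :
    P.sem x (R.pre a b w w') = true ↔ ∀ hw' : R.Mem x w',
      col ⟨w', (R.mem_part x).2 hw'⟩ < col w →
        nbrCount G col a (col ⟨w', (R.mem_part x).2 hw'⟩) =
          nbrCount G col b (col ⟨w', (R.mem_part x).2 hw'⟩) := by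
  rw [P.sem_or (R.kind_pre a b w w'), R.srcs_pre]
  simp only [mem_insert, mem_singleton, exists_eq_or_imp, exists_eq_left, wval_inr]
  rw [P.sem_nor_singleton (R.kind_nmem w') (R.srcs_nmem w'),
    P.sem_nor_singleton (R.kind_nlt w' w) (R.srcs_nlt w' w), Bool.not_eq_true', Bool.not_eq_true']
  by_cases hm : R.Mem x w'
  · have hmt : wval x (P.sem x) (R.mem w') = true := hm
    have hlt : wval x (P.sem x) (R.lt w' w) = false ↔ ¬ col ⟨w', (R.mem_part x).2 hm⟩ < col w := by
      rw [← Bool.not_eq_true, h.lt_iff ⟨w', (R.mem_part x).2 hm⟩ w]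
    rw [hmt, hlt, sem_cmp_eq h hN a b ⟨w', (R.mem_part x).2 hm⟩]
    constructor
    · rintro (h1 | h1 | h1) hw' hc
      · simp at h1
      · exact absurd hc h1
      · exact h1
    · intro H
      by_cases hc : col ⟨w', (R.mem_part x).2 hm⟩ < col w
      · exact Or.inr (Or.inr (H hm hc))
      · exact Or.inr (Or.inl hc)
  · have hmf : wval x (P.sem x) (R.mem w') = false := by
      rw [← Bool.not_eq_true]; exact hm
    simp only [hmf, true_or, true_iff]
    intro hw'
    exact absurd hw' hm

/-- `allpre u v w`. [folklore] -/
theorem sem_allpre (h : R.Reads x G col) (hN : (R.part x).card ≤ N) (a b w : R.part x) :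
    P.sem x (R.allpre a b w) = true ↔
      ∀ w' : R.part x, col w' < col w → nbrCount G col a (col w') = nbrCount G col b (col w') := by
  rw [P.sem_and (R.kind_allpre a b w), R.srcs_allpre]
  simp only [mem_image, mem_univ, true_and, forall_exists_index, forall_apply_eq_imp_iff, wval_inr,
    sem_pre h hN]
  constructor
  · rintro H ⟨w', hw'⟩ hc
    exact H w' ((R.mem_part x).1 hw') hc
  · intro H w' hw' hc
    exact H ⟨w', _⟩ hc

/-- `wit u v w`. [folklore] -/
theorem sem_wit (h : R.Reads x G col) (hN : (R.part x).card ≤ N) (a b : R.part x) (w : V) :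
    P.sem x (R.wit a b w) = true ↔ ∃ hw : R.Mem x w,
      nbrCount G col a (col ⟨w, (R.mem_part x).2 hw⟩) < nbrCount G col b (col ⟨w, (R.mem_part x).2 hw⟩) ∧
      ∀ w' : R.part x, col w' < col ⟨w, (R.mem_part x).2 hw⟩ →
        nbrCount G col a (col w') = nbrCount G col b (col w') := by
  rw [P.sem_and (R.kind_wit a b w), R.srcs_wit]
  simp only [mem_insert, mem_singleton, forall_eq_or_imp, forall_eq, wval_inr]
  constructor
  · rintro ⟨hm, hlt, hall⟩
    have hm' : R.Mem x w := hm
    refine ⟨hm', ?_, ?_⟩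
    · exact (sem_cmp_lt h hN a b ⟨w, (R.mem_part x).2 hm'⟩).1 hlt
    · exact (sem_allpre h hN a b ⟨w, (R.mem_part x).2 hm'⟩).1 hall
  · rintro ⟨hm, hlt, hall⟩
    exact ⟨hm, (sem_cmp_lt h hN a b ⟨w, _⟩).2 hlt, (sem_allpre h hN a b ⟨w, _⟩).2 hall⟩

/-- **`prof u v` carries the lexicographic comparison of the neighbour-count vectors** (`ProfLT`). [folklore] -/
theorem sem_prof (h : R.Reads x G col) (hN : (R.part x).card ≤ N) (a b : R.part x) :
    P.sem x (R.prof a b) = true ↔ ProfLT G col a b := by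
  rw [P.sem_or (R.kind_prof a b), R.srcs_prof]
  simp only [mem_image, mem_univ, true_and, exists_exists_eq_and, wval_inr, sem_wit h hN]
  unfold ProfLT
  constructor
  · rintro ⟨w, hw, hlt, hall⟩
    exact ⟨⟨w, (R.mem_part x).2 hw⟩, hlt, hall⟩
  · rintro ⟨⟨w, hwU⟩, hlt, hall⟩
    exact ⟨w, (R.mem_part x).1 hwU, hlt, hall⟩

/-- `tie u v`. [folklore] -/
theorem sem_tie (h : R.Reads x G col) (hN : (R.part x).card ≤ N) (a b : R.part x) :
    P.sem x (R.tie a b) = true ↔ col a = col b ∧ ProfLT G col a b := by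
  rw [P.sem_and (R.kind_tie a b), R.srcs_tie]
  simp only [mem_insert, mem_singleton, forall_eq_or_imp, forall_eq, wval_inr, sem_prof h hN,
    h.eq_iff a b]

/-- **`lt' u v` carries the key order `KeyLT`** of ordered colour refinement on the part. [folklore] -/
theorem sem_lt'_iff_keyLT (h : R.Reads x G col) (hN : (R.part x).card ≤ N) (a b : R.part x) :
    P.sem x (R.lt' a b) = true ↔ KeyLT G col a b := by
  rw [P.sem_or (R.kind_lt' a b), R.srcs_lt']
  simp only [mem_insert, mem_singleton, exists_eq_or_imp, exists_eq_left, wval_inr, sem_tie h hN,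
    h.lt_iff a b]
  rfl

/-- **`lt'` reads the order of the refined colouring `ocrStep G col`.** [cite: CaiFurerImmerman1992, §5 (vertex refinement)] -/
theorem sem_lt'_iff (h : R.Reads x G col) (hN : (R.part x).card ≤ N) (a b : R.part x) :
    P.sem x (R.lt' a b) = true ↔ ocrStep G col a < ocrStep G col b := by
  rw [sem_lt'_iff_keyLT h hN, ocrStep_lt_iff]

/-- **`eq'` reads the kernel of the refined colouring `ocrStep G col`.** [cite: CaiFurerImmerman1992, §5 (vertex refinement)] -/
theorem sem_eq'_iff (h : R.Reads x G col) (hN : (R.part x).card ≤ N) (a b : R.part x) :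
    P.sem x (R.eq' a b) = true ↔ ocrStep G col a = ocrStep G col b := by
  rw [P.sem_nor (R.kind_eq' a b), R.srcs_eq']
  simp only [mem_insert, mem_singleton, forall_eq_or_imp, forall_eq, wval_inr]
  rw [← Bool.not_eq_true, ← Bool.not_eq_true, sem_lt'_iff h hN, sem_lt'_iff h hN, not_lt, not_lt]
  constructor
  · rintro ⟨h1, h2⟩; exact le_antisymm h2 h1
  · intro he; rw [he]; exact ⟨le_rfl, le_rfl⟩

end RefineRound

end SymProg

end Literature.Computability.Complexity
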